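import Summits.BirchSwinnertonDyer.BirchSwinnertonDyer.Theorems.Rank2Observatory2DescClClassGen
import Summits.BirchSwinnertonDyer.BirchSwinnertonDyer.Theorems.Rank2Observatory2DescClPrimesOver
import Summits.BirchSwinnertonDyer.BirchSwinnertonDyer.Theorems.Rank2Observatory2DescClIndexCert
import HarnessLib

/-!
# KERNEL-2DESC-CL (N6d): table-driven Minkowski sweep certificates

HONEST FRAMING: per-curve certified theorems and census instruments; no claim on BSD in rank ≥ 2.

Generic companion of `Rank2Observatory2DescClClassGen.lean` (N6c).  In the field-level certificate
`H_q = ⊤` (`eq_top_of_classIn_lt`: every prime `P` above a rational prime `p < b`, `p ^ f_P < b`,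
lies in the subgroup `H_q` generated by the classes of the ideals containing the auxiliary prime
`q`) a prime `p ∤ exponent(θ)` at which `f = X³ + aX² + bX + c` has a root mod `p` was so far
discharged by a per-prime block (Dedekind–Kummer presentation of the primes above `p`, their
norms, a covering lemma, and one relation certificate `β ∈ P`, `|N β| = N(P)·q^j` per prime).
This file replaces the block by ONE lemma application whose hypotheses are integer identities
decidable by `decide`:

* `poly_eq_prod_three_add`, `poly_eq_lin_mul_quad_add` — the factorisation
  `f = ∏ (X − rᵢ) + p·S`, resp. `f = (X − r)(X² + uX + v) + p·S`, from the Vieta congruences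
  with explicit cofactors;
* `classIn_tsupp_root_cert` — a degree-one prime `(p, θ − r)` lies in `H_q` given
  `β = x + yθ + zθ²` with `x + yr + zr² = p·k` (so `β ∈ (p, θ − r)`) and `|N β| = p·q^j`
  (norm read off the integer norm form `normFormZ` of N3 `Rank2Observatory2DescClIndexCert`);
* `classIn_tsupp_quad_cert` — the same for a degree-two prime `(p, θ² + uθ + v)`:
  `x = zv + p·k₀`, `y = zu + p·k₁`, `|N β| = p²·q^j`;
* the packaged sweeps `sweep_split` (splitting types `(1)(1)(1)`, `(1)(1)²`, `(1)³`),
  `sweep_one_two` (type `(1)(2)`, both primes certified) and `sweep_one_two_of_le`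
  (type `(1)(2)`, the degree-two prime outside the sweep range `b ≤ p²`), each concluding
  `ClassIn H_q P` for every `P` above `p` exactly in the shape consumed by `eq_top_of_classIn_lt`.

Sorry-free; axioms `propext`, `Classical.choice`, `Quot.sound`.
[cite: Marcus2018, Ch. 3 Thm. 27; Ch. 5 Thm. 35, Thm. 37] [cite: Cohen1993, §4.8.2, §6.5]

## References
* D. A. Marcus, *Number Fields*, 2nd ed. (2018), Ch. 3 Thm. 27 (Dedekind–Kummer), Ch. 5 Thm. 35,
  Thm. 37 and Cor. 2 (Minkowski bound, class group from the primes below it). [Marcus2018]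
* H. Cohen, *A Course in Computational Algebraic Number Theory*, GTM 138 (1993), §4.8.2, §6.5
  (relations and class group computation). [Cohen1993]
-/

-- single-conjunct summit: `Summit.BirchSwinnertonDyer.BirchSwinnertonDyer.…` repeats the name by design
set_option linter.dupNamespace false

noncomputable section

open scoped Classical NumberField nonZeroDivisors

namespace Summit.BirchSwinnertonDyer.BirchSwinnertonDyer.Rank2Observatory.TwoDescCl

open IsDedekindDomain NumberField Ideal Polynomial Module
open Literature.NumberTheory.NumberFields Literature.NumberTheory.NumberFields.MonicCubic
open TwoDescCubic (lin)

variable {K : Type*} [Field K] [NumberField K] {a b c : ℤ} {θ : K}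

/-! ## Integer bookkeeping -/

/-- **Vieta congruences ⇒ `f = ∏ (X − rᵢ) + p·S`** with the explicit cofactor
`S = s₀ + s₁X + s₂X²`. [folklore] -/
theorem poly_eq_prod_three_add (a b c : ℤ) (p : ℕ) (r₀ r₁ r₂ s₀ s₁ s₂ : ℤ)
    (h₂ : a + (r₀ + r₁ + r₂) = p * s₂) (h₁ : b - (r₀ * r₁ + r₀ * r₂ + r₁ * r₂) = p * s₁)
    (h₀ : c + r₀ * r₁ * r₂ = p * s₀) :
    poly a b c = ∏ i, (X - C ((![r₀, r₁, r₂] : Fin 3 → ℤ) i)) +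
      C (p : ℤ) * (C s₀ + C s₁ * X + C s₂ * X ^ 2) := by
  have e₂ := congrArg (C : ℤ → ℤ[X]) h₂
  have e₁ := congrArg (C : ℤ → ℤ[X]) h₁
  have e₀ := congrArg (C : ℤ → ℤ[X]) h₀
  simp only [map_add, map_sub, map_mul] at e₂ e₁ e₀
  simp only [poly, Fin.prod_univ_succ, Fin.prod_univ_zero, Matrix.cons_val_zero,
    Matrix.cons_val_succ]
  linear_combination (X ^ 2 : ℤ[X]) * e₂ + (X : ℤ[X]) * e₁ + e₀

/-- **Vieta congruences ⇒ `f = (X − r)(X² + uX + v) + p·S`** with the explicit cofactor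
`S = s₀ + s₁X + s₂X²`. [folklore] -/
theorem poly_eq_lin_mul_quad_add (a b c : ℤ) (p : ℕ) (r u v s₀ s₁ s₂ : ℤ)
    (h₂ : a - (u - r) = p * s₂) (h₁ : b - (v - r * u) = p * s₁) (h₀ : c + r * v = p * s₀) :
    poly a b c = (X - C r) * (X ^ 2 + C u * X + C v) +
      C (p : ℤ) * (C s₀ + C s₁ * X + C s₂ * X ^ 2) := by
  have e₂ := congrArg (C : ℤ → ℤ[X]) h₂
  have e₁ := congrArg (C : ℤ → ℤ[X]) h₁
  have e₀ := congrArg (C : ℤ → ℤ[X]) h₀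
  simp only [map_add, map_sub, map_mul] at e₂ e₁ e₀
  simp only [poly]
  linear_combination (X ^ 2 : ℤ[X]) * e₂ + (X : ℤ[X]) * e₁ + e₀

omit [NumberField K] in
/-- Sweep form of "`p ∈ P` for a prime `P` above `p`": the membership fed to the covering lemmas
`primesOver_split` / `primesOver_one_two_of_no_root` (explicit `p`, cast through `ℕ`). [folklore] -/
theorem sweep_natCast_mem (p : ℕ) {P : Ideal (𝓞 K)}
    (hP : P ∈ primesOver (span {(p : ℤ)}) (𝓞 K)) : ((p : ℕ) : 𝓞 K) ∈ P := by
  have hu : ((p : ℕ) : ℤ) ∈ P.under ℤ := by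
    rw [← hP.2.over]; exact Ideal.mem_span_singleton_self _
  have h : (((p : ℕ) : ℤ) : 𝓞 K) ∈ P := hu
  simpa using h

/-! ## Relation certificates read off integer data -/

/-- **Degree-one relation certificate.** For the prime `P = (p, θ − r)` of norm `p`:
`β = x + yθ + zθ²` with `x + yr + zr² = p·k` lies in `P` (`β = k·p + (y + zr + zθ)(θ − r)`), and
`|N β| = p·q^j` puts the class of `P` in `H_q`. [cite: Marcus2018, Ch. 5, Thm. 35] -/
theorem classIn_tsupp_root_cert (hirr : Irreducible (polyQ a b c))
    (hθ : aeval θ (poly a b c) = 0) (h3 : finrank ℚ K = 3) {p : ℕ} (hp : p.Prime) {q : ℕ}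
    (hq : q.Prime) (r : ℤ) (habs : absNorm (span {(p : 𝓞 K), lin hθ (-r) 1 0}) = p)
    (x y z k : ℤ) (j : ℕ) (hk : x + y * r + z * r ^ 2 = p * k)
    (hN : (normFormZ a b c x y z).natAbs = p * q ^ j) :
    ClassIn (Subgroup.closure {cc : ClassGroup (𝓞 K) | ∃ (J : Ideal (𝓞 K))
      (hJ : J ∈ (Ideal (𝓞 K))⁰), ((q : ℕ) : 𝓞 K) ∈ J ∧ ClassGroup.mk0 ⟨J, hJ⟩ = cc})
      (span {(p : 𝓞 K), lin hθ (-r) 1 0}) := by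
  refine classIn_tsupp_span_pair_of_rel hq (span_pair_ne_bot hp _) (f := 1)
    (by rw [pow_one]; exact habs) (k : 𝓞 K) (lin hθ (y + z * r) z 0) (lin hθ x y z) ?_ j ?_
  · have hk' := congrArg (Int.cast : ℤ → 𝓞 K) hk
    push_cast at hk'
    simp only [lin]
    push_cast
    linear_combination -hk'
  · rw [pow_one, TwoDescCubic.natAbs_norm_lin hirr hθ h3 x y z (normForm_intCast a b c x y z), hN]

/-- **Degree-two relation certificate.** For the prime `P = (p, θ² + uθ + v)` of norm `p²`:
`β = x + yθ + zθ²` with `x = zv + p·k₀`, `y = zu + p·k₁` lies in `P`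
(`β = (k₀ + k₁θ)·p + z·(θ² + uθ + v)`), and `|N β| = p²·q^j` puts the class of `P` in `H_q`.
[cite: Marcus2018, Ch. 5, Thm. 35] -/
theorem classIn_tsupp_quad_cert (hirr : Irreducible (polyQ a b c))
    (hθ : aeval θ (poly a b c) = 0) (h3 : finrank ℚ K = 3) {p : ℕ} (hp : p.Prime) {q : ℕ}
    (hq : q.Prime) (u v : ℤ) (habs : absNorm (span {(p : 𝓞 K), lin hθ v u 1}) = p ^ 2)
    (x y z k₀ k₁ : ℤ) (j : ℕ) (hk₀ : x = z * v + p * k₀) (hk₁ : y = z * u + p * k₁)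
    (hN : (normFormZ a b c x y z).natAbs = p ^ 2 * q ^ j) :
    ClassIn (Subgroup.closure {cc : ClassGroup (𝓞 K) | ∃ (J : Ideal (𝓞 K))
      (hJ : J ∈ (Ideal (𝓞 K))⁰), ((q : ℕ) : 𝓞 K) ∈ J ∧ ClassGroup.mk0 ⟨J, hJ⟩ = cc})
      (span {(p : 𝓞 K), lin hθ v u 1}) := by
  refine classIn_tsupp_span_pair_of_rel hq (span_pair_ne_bot hp _) (f := 2) habs
    (lin hθ k₀ k₁ 0) (z : 𝓞 K) (lin hθ x y z) ?_ j ?_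
  · have hk₀' := congrArg (Int.cast : ℤ → 𝓞 K) hk₀
    have hk₁' := congrArg (Int.cast : ℤ → 𝓞 K) hk₁
    push_cast at hk₀' hk₁'
    simp only [lin]
    push_cast
    linear_combination -hk₀' - (thetaInt hθ) * hk₁'
  · rw [TwoDescCubic.natAbs_norm_lin hirr hθ h3 x y z (normForm_intCast a b c x y z), hN]

/-! ## Packaged sweeps -/

/-- **Sweep at a prime of splitting type `(1)(1)(1)`, `(1)(1)²` or `(1)³`** (roots `r₀ r₁ r₂`
mod `p` with multiplicity, Vieta cofactors `s₀ s₁ s₂`, one relation certificate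
`(xᵢ, yᵢ, zᵢ, kᵢ, jᵢ)` per root): every prime above `p` lies in `H_q`.
[cite: Marcus2018, Ch. 3, Thm. 27; Ch. 5, Thm. 35] -/
theorem sweep_split (hirr : Irreducible (polyQ a b c)) (hθ : aeval θ (poly a b c) = 0)
    (h3 : finrank ℚ K = 3) {p : ℕ} (hp : p.Prime)
    (hexp : ¬ p ∣ RingOfIntegers.exponent (thetaInt hθ)) {q : ℕ} (hq : q.Prime)
    (r₀ r₁ r₂ s₀ s₁ s₂ : ℤ) (x₀ y₀ z₀ k₀ : ℤ) (j₀ : ℕ) (x₁ y₁ z₁ k₁ : ℤ) (j₁ : ℕ)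
    (x₂ y₂ z₂ k₂ : ℤ) (j₂ : ℕ)
    (h : (a + (r₀ + r₁ + r₂) = p * s₂ ∧ b - (r₀ * r₁ + r₀ * r₂ + r₁ * r₂) = p * s₁ ∧
        c + r₀ * r₁ * r₂ = p * s₀) ∧
      (x₀ + y₀ * r₀ + z₀ * r₀ ^ 2 = p * k₀ ∧ (normFormZ a b c x₀ y₀ z₀).natAbs = p * q ^ j₀) ∧
      (x₁ + y₁ * r₁ + z₁ * r₁ ^ 2 = p * k₁ ∧ (normFormZ a b c x₁ y₁ z₁).natAbs = p * q ^ j₁) ∧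
      (x₂ + y₂ * r₂ + z₂ * r₂ ^ 2 = p * k₂ ∧ (normFormZ a b c x₂ y₂ z₂).natAbs = p * q ^ j₂))
    (P : Ideal (𝓞 K)) (hP : P ∈ primesOver (span {(p : ℤ)}) (𝓞 K)) :
    ClassIn (Subgroup.closure {cc : ClassGroup (𝓞 K) | ∃ (J : Ideal (𝓞 K))
      (hJ : J ∈ (Ideal (𝓞 K))⁰), ((q : ℕ) : 𝓞 K) ∈ J ∧ ClassGroup.mk0 ⟨J, hJ⟩ = cc}) P := by
  obtain ⟨hprimes, hcover⟩ := primesOver_split hirr hθ hp hexp ![r₀, r₁, r₂]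
    (C s₀ + C s₁ * X + C s₂ * X ^ 2)
    (poly_eq_prod_three_add a b c p r₀ r₁ r₂ s₀ s₁ s₂ h.1.1 h.1.2.1 h.1.2.2)
  obtain ⟨i, rfl⟩ := hcover P hP.1 (sweep_natCast_mem p hP)
  fin_cases i
  · exact classIn_tsupp_root_cert hirr hθ h3 hp hq r₀ (hprimes 0).2 x₀ y₀ z₀ k₀ j₀
      h.2.1.1 h.2.1.2
  · exact classIn_tsupp_root_cert hirr hθ h3 hp hq r₁ (hprimes 1).2 x₁ y₁ z₁ k₁ j₁
      h.2.2.1.1 h.2.2.1.2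
  · exact classIn_tsupp_root_cert hirr hθ h3 hp hq r₂ (hprimes 2).2 x₂ y₂ z₂ k₂ j₂
      h.2.2.2.1 h.2.2.2.2

/-- **Sweep at a prime of splitting type `(1)(2)`, both primes certified** (root `r`, rootless
quadratic `X² + uX + v` mod `p`, Vieta cofactors, a degree-one certificate `(x₀, y₀, z₀, k₀, j₀)`
and a degree-two certificate `(x₁, y₁, z₁, k₁, k₁', j₁)`): every prime above `p` lies in `H_q`.
[cite: Marcus2018, Ch. 3, Thm. 27; Ch. 5, Thm. 35] -/
theorem sweep_one_two (hirr : Irreducible (polyQ a b c)) (hθ : aeval θ (poly a b c) = 0)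
    (h3 : finrank ℚ K = 3) {p : ℕ} (hp : p.Prime)
    (hexp : ¬ p ∣ RingOfIntegers.exponent (thetaInt hθ)) {q : ℕ} (hq : q.Prime)
    (r u v s₀ s₁ s₂ : ℤ) (x₀ y₀ z₀ k₀ : ℤ) (j₀ : ℕ) (x₁ y₁ z₁ k₁ k₁' : ℤ) (j₁ : ℕ)
    (hnr : ∀ t : ZMod p, t ^ 2 + (u : ZMod p) * t + (v : ZMod p) ≠ 0)
    (h : (a - (u - r) = p * s₂ ∧ b - (v - r * u) = p * s₁ ∧ c + r * v = p * s₀) ∧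
      (x₀ + y₀ * r + z₀ * r ^ 2 = p * k₀ ∧ (normFormZ a b c x₀ y₀ z₀).natAbs = p * q ^ j₀) ∧
      (x₁ = z₁ * v + p * k₁ ∧ y₁ = z₁ * u + p * k₁' ∧
        (normFormZ a b c x₁ y₁ z₁).natAbs = p ^ 2 * q ^ j₁))
    (P : Ideal (𝓞 K)) (hP : P ∈ primesOver (span {(p : ℤ)}) (𝓞 K)) :
    ClassIn (Subgroup.closure {cc : ClassGroup (𝓞 K) | ∃ (J : Ideal (𝓞 K))
      (hJ : J ∈ (Ideal (𝓞 K))⁰), ((q : ℕ) : 𝓞 K) ∈ J ∧ ClassGroup.mk0 ⟨J, hJ⟩ = cc}) P := by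
  obtain ⟨h₁, h₂, hcover⟩ := primesOver_one_two_of_no_root hirr hθ hp hexp r u v
    (C s₀ + C s₁ * X + C s₂ * X ^ 2)
    (poly_eq_lin_mul_quad_add a b c p r u v s₀ s₁ s₂ h.1.1 h.1.2.1 h.1.2.2) hnr
  rcases hcover P hP.1 (sweep_natCast_mem p hP) with rfl | rfl
  · exact classIn_tsupp_root_cert hirr hθ h3 hp hq r h₁.2 x₀ y₀ z₀ k₀ j₀ h.2.1.1 h.2.1.2
  · exact classIn_tsupp_quad_cert hirr hθ h3 hp hq u v h₂.2 x₁ y₁ z₁ k₁ k₁' j₁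
      h.2.2.1 h.2.2.2.1 h.2.2.2.2

/-- **Sweep at a prime of splitting type `(1)(2)`, degree-two prime out of range** (`b ≤ p²`, so
only the degree-one prime `(p, θ − r)` is below the sweep bound; one certificate
`(x₀, y₀, z₀, k₀, j₀)`): every prime `P` above `p` with `p ^ f_P < b` lies in `H_q`.
[cite: Marcus2018, Ch. 3, Thm. 27; Ch. 5, Thm. 35, Thm. 37] -/
theorem sweep_one_two_of_le (hirr : Irreducible (polyQ a b c)) (hθ : aeval θ (poly a b c) = 0)
    (h3 : finrank ℚ K = 3) {p : ℕ} (hp : p.Prime)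
    (hexp : ¬ p ∣ RingOfIntegers.exponent (thetaInt hθ)) {q : ℕ} (hq : q.Prime)
    (r u v s₀ s₁ s₂ : ℤ) (x₀ y₀ z₀ k₀ : ℤ) (j₀ : ℕ)
    (hnr : ∀ t : ZMod p, t ^ 2 + (u : ZMod p) * t + (v : ZMod p) ≠ 0)
    (h : (a - (u - r) = p * s₂ ∧ b - (v - r * u) = p * s₁ ∧ c + r * v = p * s₀) ∧
      (x₀ + y₀ * r + z₀ * r ^ 2 = p * k₀ ∧ (normFormZ a b c x₀ y₀ z₀).natAbs = p * q ^ j₀))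
    {bM : ℕ} (hb : bM ≤ p ^ 2)
    (P : Ideal (𝓞 K)) (hP : P ∈ primesOver (span {(p : ℤ)}) (𝓞 K))
    (hlt : p ^ P.inertiaDeg ℤ < bM) :
    ClassIn (Subgroup.closure {cc : ClassGroup (𝓞 K) | ∃ (J : Ideal (𝓞 K))
      (hJ : J ∈ (Ideal (𝓞 K))⁰), ((q : ℕ) : 𝓞 K) ∈ J ∧ ClassGroup.mk0 ⟨J, hJ⟩ = cc}) P := by
  obtain ⟨h₁, h₂, hcover⟩ := primesOver_one_two_of_no_root hirr hθ hp hexp r u v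
    (C s₀ + C s₁ * X + C s₂ * X ^ 2)
    (poly_eq_lin_mul_quad_add a b c p r u v s₀ s₁ s₂ h.1.1 h.1.2.1 h.1.2.2) hnr
  rcases hcover P hP.1 (sweep_natCast_mem p hP) with rfl | rfl
  · exact classIn_tsupp_root_cert hirr hθ h3 hp hq r h₁.2 x₀ y₀ z₀ k₀ j₀ h.2.1 h.2.2
  · exact absurd hlt (not_pow_inertiaDeg_lt hP h₂.2 hb)

end Summit.BirchSwinnertonDyer.BirchSwinnertonDyer.Rank2Observatory.TwoDescCl

end
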